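import Summits.HodgeConjecture.CorCM.StabiliserOrbitSelfConjugatePartners
import Summits.HodgeConjecture.CorCM.PairFlipCMFieldsSplitOffHodge
import HarnessLib

/-!
# (SC) slots SPLIT OFF: in a family of CM types, the slots whose CM fields have self-conjugate stabiliser orbits and which
# differ from every other slot in DEGREE or in GALOIS CLOSURE can be removed without changing nondegeneracy —
# products of (SC) CM abelian varieties of pairwise distinct dimensions or closures

COR-CM (cell `pub-hodgecm2`, binder seat `b16` gen 54, count-neutral claim STAB-CONJ, file F6; theorems only, no definition,
no named fact, no `sorry`).  NEW as stated, hence under `Summits/`.  HONEST FRAMING: unconditional theorems on products of CM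
abelian varieties of arbitrary dimensions; `HC_CM` is neither used nor advanced.  The (SC) form of this seat's gen-44
`CorCM/PairFlipCMFieldsSplitOffHodge` (pair-flip slots with distinct closures split off), with the DEGREE alternative of F3.

SETTING.  A finite family `(K_i; Φ_i)_{i ∈ I}` of CM types and a set `p ⊆ I` of (SC) SLOTS: for `i ∈ p`,
`∀ x₀ x : K_i → ℂ, x ∉ {x₀, x̄₀} → ∃ σ ∈ Aut(ℂ), σ ∘ x₀ = x₀ ∧ σ ∘ x = x̄` (F1/F2: pair-flip fields, double-flip fields,
`K⁺` Galois with `Aut(K) = {1, ρ}`, `GL₂(𝔽₃)`-octics, every imaginary quadratic field …; then `U(Φ_i)` is irreducible of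
dimension `[K_i:ℚ]/2` and `Φ_i` is nondegenerate, F3 `irreducible_and_isNondegenerate_of_stabConj`).  HYPOTHESES: (h1) two
different (SC) slots have DIFFERENT DEGREES or DIFFERENT Galois closures `L_i ≠ L_j ≤ ℂ`; (h2) an (SC) slot `i` and a slot
`j ∉ p` have `[K_j:ℚ] < [K_i:ℚ]` or `L_i ⊄ L_j`.  Then no (SC) slot shares a constituent with any other slot (different
degrees: p2's `pairwise_of_irreducible_of_finrank_le` — an irreducible module of dimension `[K_i:ℚ]/2` does not embed in a
smaller one; closures: gen 43's criterion (κ) `pairwise_of_irreducible_of_not_normalClosure_le`), and the block criterion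
`isNondegenerateFamily_of_fibers` gives:

* §1 `pairwise_stabConj_of_finrank_lt_or_not_le`, `pairwise_stabConj_stabConj`;
  **`isNondegenerateFamily_iff_of_stabConj_slots`** — `(Φ_i)_i` is nondegenerate IFF the sub-family OUTSIDE `p` is;
  **`isNondegenerateFamily_stabConj_of_pairwise`** — ALL slots (SC), pairwise of different degree or different closure ⟹
  nondegenerate.  In particular CM abelian varieties of PAIRWISE DISTINCT DIMENSIONS with (SC) fields — an elliptic curve,
  a simple surface with non-Galois quartic field, a generic threefold, a `GL₂(𝔽₃)`- or `W(D₄)`-fourfold, … — have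
  `Hg(∏ A_i) = ∏ Hg(A_i)` with no hypothesis relating the fields (`isNondegenerateFamily_stabConj_of_finrank_injective`).
* §2 abelian varieties: **`hodgeConjectureFor_prod_stabConj_of_pairwise`**, `…_of_finrank_injective`,
  `not_exists_exceptional_prod_stabConj_of_pairwise` (the Hodge conjecture with `B• = D•` on every `⨁_{j<N} A_{π j}`,
  UNCONDITIONALLY; no exceptional class anywhere), **`hodgeConjectureFor_prod_of_stabConj_slots`** and
  `exists_exceptional_prod_iff_of_stabConj_slots` (exceptional classes live outside the (SC) slots).

What is NOT split off: two (SC) slots of the SAME degree inside ONE closure (twins; e.g. the `16` collapsing type pairs of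
two triality-twin `W(D₄)`-octics found by the seat's GAP census) — decided by F3/F4's criteria instead.

## References

* [Gordon1999HodgeAVSurvey] B. B. Gordon, *A survey of the Hodge conjecture for abelian varieties*, §3 Theorem, 7.4–7.7,
  10.10.
* [Dodson1984] B. Dodson, *The structure of Galois groups of CM-fields*, Trans. AMS 283 (1984), §1.1, §5.1.2.
* [MoonenZarhin1999LowDim] B. Moonen, Yu. Zarhin, *Hodge classes on abelian varieties of low dimension*, Math. Ann. 315
  (1999), §3 (3.1).
* [Serre1977] J.-P. Serre, *Linear Representations of Finite Groups*, GTM 42, §2.2.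
-/

set_option autoImplicit false

noncomputable section

open CategoryTheory CategoryTheory.Limits NumberField Module IntermediateField

namespace Summit.HodgeConjecture.CorCM

open Literature.NumberTheory.ComplexMultiplication
open Literature.AlgebraicGeometry.Motives (AbelianVariety CMType)
open Literature.AlgebraicGeometry.HodgeTheory
open Literature.AlgebraicGeometry.ComplexMultiplication (IsCMTypeRealisation)
open Literature.AlgebraicGeometry.VanGeemen1994 (hodgeClassSpan)
open Literature.AlgebraicGeometry.Pohlmann1968
open Literature.Barriers.HodgeConjecture (divisorClassesSpan)

variable {I : Type} {K : I → Type} [∀ i, Field (K i)] [∀ i, NumberField (K i)] [∀ i, IsCMField (K i)]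
  {Φ : ∀ i, CMType (K i)}

/-! ## §1 Types -/

section Pairs

/-- **An (SC) slot against a slot of smaller degree OR with `L_i ⊄ L_j`: no common constituent** (both orders).
[cite: Gordon1999HodgeAVSurvey, §3 Theorem (proof)] [cite: Serre1977, §2.2] -/
theorem pairwise_stabConj_of_finrank_lt_or_not_le {i j : I}
    (hSC : ∀ x₀ x : K i →+* ℂ, x ≠ x₀ → x ≠ (starRingAut : ℂ ≃+* ℂ) • x₀ →
      ∃ σ : ℂ ≃+* ℂ, σ • x₀ = x₀ ∧ σ • x = (starRingAut : ℂ ≃+* ℂ) • x)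
    (h : finrank ℚ (K j) < finrank ℚ (K i) ∨ ¬ normalClosure ℚ (K i) ℂ ≤ normalClosure ℚ (K j) ℂ) :
    (∀ P : Submodule ℚ ((K i →+* ℂ) → ℚ), P ≤ antiSpan (ℂ ≃+* ℂ) (Φ i).1 →
      (∀ g : ℂ ≃+* ℂ, ∀ f ∈ P, (fun x => f (g • x)) ∈ P) →
      ∀ T : ((K i →+* ℂ) → ℚ) →ₗ[ℚ] ((K j →+* ℂ) → ℚ),
        (∀ g : ℂ ≃+* ℂ, ∀ f ∈ P, T (fun x => f (g • x)) = fun y => T f (g • y)) →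
        (∀ f ∈ P, T f ∈ antiSpan (ℂ ≃+* ℂ) (Φ j).1) → (∀ f ∈ P, T f = 0 → f = 0) → P = ⊥) ∧
    (∀ P : Submodule ℚ ((K j →+* ℂ) → ℚ), P ≤ antiSpan (ℂ ≃+* ℂ) (Φ j).1 →
      (∀ g : ℂ ≃+* ℂ, ∀ f ∈ P, (fun x => f (g • x)) ∈ P) →
      ∀ T : ((K j →+* ℂ) → ℚ) →ₗ[ℚ] ((K i →+* ℂ) → ℚ),
        (∀ g : ℂ ≃+* ℂ, ∀ f ∈ P, T (fun x => f (g • x)) = fun y => T f (g • y)) →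
        (∀ f ∈ P, T f ∈ antiSpan (ℂ ≃+* ℂ) (Φ i).1) → (∀ f ∈ P, T f = 0 → f = 0) → P = ⊥) := by
  rcases h with hlt | hL
  · have h' := pairwise_of_stabConj_of_finrank_lt Φ hSC hlt
    exact ⟨h'.2, h'.1⟩
  · obtain ⟨hirr, -, hnd⟩ := irreducible_and_isNondegenerate_of_stabConj Φ hSC
    exact pairwise_of_irreducible_of_not_normalClosure_le (Φ := Φ) hirr hnd hL

/-- **Two (SC) slots of different degree OR different closure: no common constituent.**
[cite: Gordon1999HodgeAVSurvey, §3 Theorem (proof)] [cite: Dodson1984, §5.1.2] -/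
theorem pairwise_stabConj_stabConj {i j : I}
    (hSCi : ∀ x₀ x : K i →+* ℂ, x ≠ x₀ → x ≠ (starRingAut : ℂ ≃+* ℂ) • x₀ →
      ∃ σ : ℂ ≃+* ℂ, σ • x₀ = x₀ ∧ σ • x = (starRingAut : ℂ ≃+* ℂ) • x)
    (hSCj : ∀ x₀ x : K j →+* ℂ, x ≠ x₀ → x ≠ (starRingAut : ℂ ≃+* ℂ) • x₀ →
      ∃ σ : ℂ ≃+* ℂ, σ • x₀ = x₀ ∧ σ • x = (starRingAut : ℂ ≃+* ℂ) • x)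
    (h : finrank ℚ (K i) ≠ finrank ℚ (K j) ∨ normalClosure ℚ (K i) ℂ ≠ normalClosure ℚ (K j) ℂ) :
    (∀ P : Submodule ℚ ((K i →+* ℂ) → ℚ), P ≤ antiSpan (ℂ ≃+* ℂ) (Φ i).1 →
      (∀ g : ℂ ≃+* ℂ, ∀ f ∈ P, (fun x => f (g • x)) ∈ P) →
      ∀ T : ((K i →+* ℂ) → ℚ) →ₗ[ℚ] ((K j →+* ℂ) → ℚ),
        (∀ g : ℂ ≃+* ℂ, ∀ f ∈ P, T (fun x => f (g • x)) = fun y => T f (g • y)) →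
        (∀ f ∈ P, T f ∈ antiSpan (ℂ ≃+* ℂ) (Φ j).1) → (∀ f ∈ P, T f = 0 → f = 0) → P = ⊥) ∧
    (∀ P : Submodule ℚ ((K j →+* ℂ) → ℚ), P ≤ antiSpan (ℂ ≃+* ℂ) (Φ j).1 →
      (∀ g : ℂ ≃+* ℂ, ∀ f ∈ P, (fun x => f (g • x)) ∈ P) →
      ∀ T : ((K j →+* ℂ) → ℚ) →ₗ[ℚ] ((K i →+* ℂ) → ℚ),
        (∀ g : ℂ ≃+* ℂ, ∀ f ∈ P, T (fun x => f (g • x)) = fun y => T f (g • y)) →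
        (∀ f ∈ P, T f ∈ antiSpan (ℂ ≃+* ℂ) (Φ i).1) → (∀ f ∈ P, T f = 0 → f = 0) → P = ⊥) := by
  rcases h with hdeg | hne
  · rcases lt_or_gt_of_ne hdeg with hlt | hgt
    · have h' := pairwise_of_stabConj_of_finrank_lt Φ hSCj hlt
      exact ⟨h'.1, h'.2⟩
    · have h' := pairwise_of_stabConj_of_finrank_lt Φ hSCi hgt
      exact ⟨h'.2, h'.1⟩
  · by_cases hle : normalClosure ℚ (K i) ℂ ≤ normalClosure ℚ (K j) ℂ
    · have hL : ¬ normalClosure ℚ (K j) ℂ ≤ normalClosure ℚ (K i) ℂ := fun h' => hne (le_antisymm hle h')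
      have h' := pairwise_stabConj_of_finrank_lt_or_not_le (Φ := Φ) hSCj (Or.inr hL)
      exact ⟨h'.2, h'.1⟩
    · exact pairwise_stabConj_of_finrank_lt_or_not_le (Φ := Φ) hSCi (Or.inr hle)

end Pairs

section Types

variable [Fintype I] [DecidableEq I] [Nonempty I]

/-- **(SC) SLOTS SPLIT OFF.**  Let `p ⊆ I` consist of (SC) slots such that (h1) two different (SC) slots differ in degree or
in Galois closure and (h2) an (SC) slot and a slot outside `p` satisfy `[K_j:ℚ] < [K_i:ℚ]` or `L_i ⊄ L_j`.  Then the family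
`(Φ_i)_i` is nondegenerate IFF its sub-family outside `p` is. [cite: Gordon1999HodgeAVSurvey, 7.5–7.7 and 7.6.1]
[cite: MoonenZarhin1999LowDim, §3 (3.1)] -/
theorem isNondegenerateFamily_iff_of_stabConj_slots (p : I → Prop) [DecidablePred p]
    (hSC : ∀ i, p i → ∀ x₀ x : K i →+* ℂ, x ≠ x₀ → x ≠ (starRingAut : ℂ ≃+* ℂ) • x₀ →
      ∃ σ : ℂ ≃+* ℂ, σ • x₀ = x₀ ∧ σ • x = (starRingAut : ℂ ≃+* ℂ) • x)
    (h1 : ∀ i j, i ≠ j → p i → p j →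
      finrank ℚ (K i) ≠ finrank ℚ (K j) ∨ normalClosure ℚ (K i) ℂ ≠ normalClosure ℚ (K j) ℂ)
    (h2 : ∀ i j, p i → ¬ p j →
      finrank ℚ (K j) < finrank ℚ (K i) ∨ ¬ normalClosure ℚ (K i) ℂ ≤ normalClosure ℚ (K j) ℂ) :
    CMAlgebra.IsNondegenerateFamily Φ ↔
      ((∃ i, ¬ p i) → CMAlgebra.IsNondegenerateFamily (K := fun i : {i // ¬ p i} => K i.1) fun i => Φ i.1) := by
  classical
  refine ⟨fun hΦ hex => isNondegenerateFamily_subtype hΦ (fun i => ¬ p i) hex, fun hrest => ?_⟩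
  -- blocks: `some i` for an (SC) slot `i`, `none` for the rest
  let κ : I → Option I := fun i => if p i then some i else none
  have hκp : ∀ i, p i → κ i = some i := fun i hi => by simp only [κ, if_pos hi]
  have hκn : ∀ i, ¬ p i → κ i = none := fun i hi => by simp only [κ, if_neg hi]
  refine isNondegenerateFamily_of_fibers Φ κ (fun i j hij => ?_) (fun c hc => ?_)
  · -- slots in different blocks share no constituent
    by_cases hi : p i
    · by_cases hj : p j
      · have hne : i ≠ j := by rintro rfl; exact hij rfl
        exact (pairwise_stabConj_stabConj (Φ := Φ) (hSC i hi) (hSC j hj) (h1 i j hne hi hj)).1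
      · exact (pairwise_stabConj_of_finrank_lt_or_not_le (Φ := Φ) (hSC i hi) (h2 i j hi hj)).1
    · by_cases hj : p j
      · exact (pairwise_stabConj_of_finrank_lt_or_not_le (Φ := Φ) (hSC j hj) (h2 j i hj hi)).2
      · exact absurd ((hκn i hi).trans (hκn j hj).symm) hij
  · -- every block is nondegenerate
    obtain ⟨i₀, hi₀⟩ := hc
    by_cases hp0 : p i₀
    · -- the block of an (SC) slot is the slot itself
      rw [hκp i₀ hp0] at hi₀
      subst hi₀
      haveI : Nonempty {i // κ i = some i₀} := ⟨⟨i₀, hκp i₀ hp0⟩⟩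
      haveI : Subsingleton {i // κ i = some i₀} := ⟨fun a b => Subtype.ext (by
        have ha := a.2
        have hb := b.2
        by_cases hpa : p a.1
        · by_cases hpb : p b.1
          · rw [hκp _ hpa] at ha; rw [hκp _ hpb] at hb
            exact (Option.some_injective _ ha).trans (Option.some_injective _ hb).symm
          · rw [hκn _ hpb] at hb; exact absurd hb (by simp)
        · rw [hκn _ hpa] at ha; exact absurd ha (by simp))⟩
      refine isNondegenerateFamily_of_subsingleton (K := fun i : {i // κ i = some i₀} => K i.1) (fun i => Φ i.1)
        fun i => ?_
      have hpi : p i.1 := by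
        by_contra h
        have := i.2
        rw [hκn _ h] at this
        exact absurd this (by simp)
      exact (irreducible_and_isNondegenerate_of_stabConj Φ (hSC i.1 hpi)).2.2
    · -- the block of the rest is the sub-family outside `p`
      rw [hκn i₀ hp0] at hi₀
      subst hi₀
      let e : {i // ¬ p i} ≃ {i // κ i = none} := Equiv.subtypeEquivRight fun i => by
        constructor
        · intro h; exact hκn i h
        · intro h hpi; rw [hκp i hpi] at h; exact absurd h (by simp)
      exact (isNondegenerateFamily_iff_of_equiv (K := fun i : {i // κ i = none} => K i.1) (fun i => Φ i.1) e).1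
        (hrest ⟨i₀, hp0⟩)

/-- **ALL SLOTS (SC), PAIRWISE OF DIFFERENT DEGREE OR DIFFERENT CLOSURE ⟹ NONDEGENERATE**: `Hg(∏ A_i) = ∏ Hg(A_i)` for
the corresponding CM abelian varieties, of any dimensions, with no further hypothesis relating the fields.
[cite: Gordon1999HodgeAVSurvey, §3 Theorem and 7.5–7.7] [cite: Dodson1984, §1.1] -/
theorem isNondegenerateFamily_stabConj_of_pairwise
    (hSC : ∀ i, ∀ x₀ x : K i →+* ℂ, x ≠ x₀ → x ≠ (starRingAut : ℂ ≃+* ℂ) • x₀ →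
      ∃ σ : ℂ ≃+* ℂ, σ • x₀ = x₀ ∧ σ • x = (starRingAut : ℂ ≃+* ℂ) • x)
    (hne : ∀ i j, i ≠ j →
      finrank ℚ (K i) ≠ finrank ℚ (K j) ∨ normalClosure ℚ (K i) ℂ ≠ normalClosure ℚ (K j) ℂ) :
    CMAlgebra.IsNondegenerateFamily Φ :=
  (isNondegenerateFamily_iff_of_stabConj_slots (Φ := Φ) (fun _ => True) (fun i _ => hSC i)
    (fun i j hij _ _ => hne i j hij) (fun _ _ _ h => absurd trivial h)).2 fun ⟨_, h⟩ => absurd trivial h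

/-- **(SC) FIELDS OF PAIRWISE DISTINCT DEGREES ⟹ every family of their CM types is nondegenerate** — e.g. an imaginary
quadratic field, a non-Galois quartic CM field, a generic sextic and a `GL₂(𝔽₃)`- or `W(D₄)`-octic: `Hg(E × S × T × F) =
Hg(E) × Hg(S) × Hg(T) × Hg(F)`. [cite: Gordon1999HodgeAVSurvey, §3 Theorem and 7.5–7.7] -/
theorem isNondegenerateFamily_stabConj_of_finrank_injective
    (hSC : ∀ i, ∀ x₀ x : K i →+* ℂ, x ≠ x₀ → x ≠ (starRingAut : ℂ ≃+* ℂ) • x₀ →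
      ∃ σ : ℂ ≃+* ℂ, σ • x₀ = x₀ ∧ σ • x = (starRingAut : ℂ ≃+* ℂ) • x)
    (hdeg : Function.Injective fun i => finrank ℚ (K i)) : CMAlgebra.IsNondegenerateFamily Φ :=
  isNondegenerateFamily_stabConj_of_pairwise hSC fun _ _ hij => Or.inl fun h => hij (hdeg h)

end Types

/-! ## §2 Abelian varieties -/

section Geometry

variable [Fintype I] [DecidableEq I] [Nonempty I] {A : I → AbelianVariety ℂ} {ι : ∀ i, 𝓞 (K i) →+* End (A i)}
  {θ : ∀ i, K i →+* Module.End ℂ (complexBetti (A i).X 1)}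

/-- **The Hodge conjecture on every `⨁_{j<N} A_{π j}`** (every `∏ A_i^{k_i}`), with `B• = D•` there, for CM abelian varieties
`A_i` of ANY dimensions realising types of (SC) fields, pairwise of different degree or different Galois closure —
UNCONDITIONALLY. [cite: Gordon1999HodgeAVSurvey, §3 Theorem, 7.5 and 10.10] -/
theorem hodgeConjectureFor_prod_stabConj_of_pairwise
    (hSC : ∀ i, ∀ x₀ x : K i →+* ℂ, x ≠ x₀ → x ≠ (starRingAut : ℂ ≃+* ℂ) • x₀ →
      ∃ σ : ℂ ≃+* ℂ, σ • x₀ = x₀ ∧ σ • x = (starRingAut : ℂ ≃+* ℂ) • x)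
    (hne : ∀ i j, i ≠ j →
      finrank ℚ (K i) ≠ finrank ℚ (K j) ∨ normalClosure ℚ (K i) ℂ ≠ normalClosure ℚ (K j) ℂ)
    (hA : ∀ i, IsCMTypeRealisation (Φ i) (A i) (ι i) (θ i)) {N : ℕ} (π : Fin N → I) :
    HodgeConjectureFor (⨁ fun j : Fin N => A (π j)).dim (⨁ fun j : Fin N => A (π j)).X ∧
      ∀ m : ℕ, hodgeClassSpan (⨁ fun j : Fin N => A (π j)).dim (⨁ fun j : Fin N => A (π j)).X m =
        divisorClassesSpan (⨁ fun j : Fin N => A (π j)).X (⨁ fun j : Fin N => A (π j)).dim m :=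
  have h := isNondegenerateFamily_stabConj_of_pairwise (Φ := Φ) hSC hne
  ⟨h.hodgeConjectureFor_prod hA π, fun m => h.hodgeClassSpan_prod_eq_divisorClassesSpan hA π m⟩

/-- **The Hodge conjecture on every product of CM abelian varieties of PAIRWISE DISTINCT DIMENSIONS whose CM fields are
(SC)** (with `B• = D•`), UNCONDITIONALLY. [cite: Gordon1999HodgeAVSurvey, §3 Theorem, 7.5 and 10.10] -/
theorem hodgeConjectureFor_prod_stabConj_of_finrank_injective
    (hSC : ∀ i, ∀ x₀ x : K i →+* ℂ, x ≠ x₀ → x ≠ (starRingAut : ℂ ≃+* ℂ) • x₀ →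
      ∃ σ : ℂ ≃+* ℂ, σ • x₀ = x₀ ∧ σ • x = (starRingAut : ℂ ≃+* ℂ) • x)
    (hdeg : Function.Injective fun i => finrank ℚ (K i))
    (hA : ∀ i, IsCMTypeRealisation (Φ i) (A i) (ι i) (θ i)) {N : ℕ} (π : Fin N → I) :
    HodgeConjectureFor (⨁ fun j : Fin N => A (π j)).dim (⨁ fun j : Fin N => A (π j)).X ∧
      ∀ m : ℕ, hodgeClassSpan (⨁ fun j : Fin N => A (π j)).dim (⨁ fun j : Fin N => A (π j)).X m =
        divisorClassesSpan (⨁ fun j : Fin N => A (π j)).X (⨁ fun j : Fin N => A (π j)).dim m :=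
  have h := isNondegenerateFamily_stabConj_of_finrank_injective (Φ := Φ) hSC hdeg
  ⟨h.hodgeConjectureFor_prod hA π, fun m => h.hodgeClassSpan_prod_eq_divisorClassesSpan hA π m⟩

/-- **No product carries an exceptional Hodge class** in the situation of `isNondegenerateFamily_stabConj_of_pairwise`.
[cite: Gordon1999HodgeAVSurvey, 7.5 and 7.6.1] -/
theorem not_exists_exceptional_prod_stabConj_of_pairwise
    (hSC : ∀ i, ∀ x₀ x : K i →+* ℂ, x ≠ x₀ → x ≠ (starRingAut : ℂ ≃+* ℂ) • x₀ →
      ∃ σ : ℂ ≃+* ℂ, σ • x₀ = x₀ ∧ σ • x = (starRingAut : ℂ ≃+* ℂ) • x)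
    (hne : ∀ i j, i ≠ j →
      finrank ℚ (K i) ≠ finrank ℚ (K j) ∨ normalClosure ℚ (K i) ℂ ≠ normalClosure ℚ (K j) ℂ)
    (hA : ∀ i, IsCMTypeRealisation (Φ i) (A i) (ι i) (θ i)) {N : ℕ} (π : Fin N → I) (m : ℕ) :
    ¬∃ c : complexBetti (⨁ fun j : Fin N => A (π j)).X (2 * m), IsRationalClass c ∧
        IsOfHodgeType (⨁ fun j : Fin N => A (π j)).dim (⨁ fun j : Fin N => A (π j)).X (2 * m) m m c ∧
        c ∉ divisorClassesSpan (⨁ fun j : Fin N => A (π j)).X (⨁ fun j : Fin N => A (π j)).dim m :=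
  (isNondegenerateFamily_stabConj_of_pairwise (Φ := Φ) hSC hne).not_exists_exceptional_prod hA π m

/-- **The Hodge conjecture on every `⨁_{j<N} A_{π j}` when the sub-family outside the (SC) slots is nondegenerate** (with
(h1), (h2)): the (SC) members come for free. UNCONDITIONAL. [cite: Gordon1999HodgeAVSurvey, §3 Theorem, 7.5–7.7 and 10.10]
[cite: MoonenZarhin1999LowDim, §3 (3.1)] -/
theorem hodgeConjectureFor_prod_of_stabConj_slots (p : I → Prop) [DecidablePred p]
    (hSC : ∀ i, p i → ∀ x₀ x : K i →+* ℂ, x ≠ x₀ → x ≠ (starRingAut : ℂ ≃+* ℂ) • x₀ →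
      ∃ σ : ℂ ≃+* ℂ, σ • x₀ = x₀ ∧ σ • x = (starRingAut : ℂ ≃+* ℂ) • x)
    (h1 : ∀ i j, i ≠ j → p i → p j →
      finrank ℚ (K i) ≠ finrank ℚ (K j) ∨ normalClosure ℚ (K i) ℂ ≠ normalClosure ℚ (K j) ℂ)
    (h2 : ∀ i j, p i → ¬ p j →
      finrank ℚ (K j) < finrank ℚ (K i) ∨ ¬ normalClosure ℚ (K i) ℂ ≤ normalClosure ℚ (K j) ℂ)
    (hrest : (∃ i, ¬ p i) → CMAlgebra.IsNondegenerateFamily (K := fun i : {i // ¬ p i} => K i.1) fun i => Φ i.1)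
    (hA : ∀ i, IsCMTypeRealisation (Φ i) (A i) (ι i) (θ i)) {N : ℕ} (π : Fin N → I) :
    HodgeConjectureFor (⨁ fun j : Fin N => A (π j)).dim (⨁ fun j : Fin N => A (π j)).X ∧
      ∀ m : ℕ, hodgeClassSpan (⨁ fun j : Fin N => A (π j)).dim (⨁ fun j : Fin N => A (π j)).X m =
        divisorClassesSpan (⨁ fun j : Fin N => A (π j)).X (⨁ fun j : Fin N => A (π j)).dim m :=
  have h := (isNondegenerateFamily_iff_of_stabConj_slots (Φ := Φ) p hSC h1 h2).2 hrest
  ⟨h.hodgeConjectureFor_prod hA π, fun m => h.hodgeClassSpan_prod_eq_divisorClassesSpan hA π m⟩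

/-- **Exceptional classes live outside the (SC) slots**: for SIMPLE, pairwise non-isogenous realisations with (h1), (h2),
some product `⨁_{j<N} A_{π j}` carries an exceptional Hodge class iff the sub-family outside `p` is degenerate.
[cite: Gordon1999HodgeAVSurvey, 7.5 (1) ⟺ (3) and 7.6.1] -/
theorem exists_exceptional_prod_iff_of_stabConj_slots (p : I → Prop) [DecidablePred p]
    (hSC : ∀ i, p i → ∀ x₀ x : K i →+* ℂ, x ≠ x₀ → x ≠ (starRingAut : ℂ ≃+* ℂ) • x₀ →
      ∃ σ : ℂ ≃+* ℂ, σ • x₀ = x₀ ∧ σ • x = (starRingAut : ℂ ≃+* ℂ) • x)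
    (h1 : ∀ i j, i ≠ j → p i → p j →
      finrank ℚ (K i) ≠ finrank ℚ (K j) ∨ normalClosure ℚ (K i) ℂ ≠ normalClosure ℚ (K j) ℂ)
    (h2 : ∀ i j, p i → ¬ p j →
      finrank ℚ (K j) < finrank ℚ (K i) ∨ ¬ normalClosure ℚ (K i) ℂ ≤ normalClosure ℚ (K j) ℂ)
    (hA : ∀ i, IsCMTypeRealisation (Φ i) (A i) (ι i) (θ i)) (hS : ∀ i, (A i).IsSimple)
    (hniso : ∀ i j, i ≠ j → ¬ AbelianVariety.IsIsogenous (A i) (A j)) :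
    (∃ (N : ℕ) (π : Fin N → I) (m : ℕ) (c : complexBetti (⨁ fun j : Fin N => A (π j)).X (2 * m)),
      IsRationalClass c ∧
      IsOfHodgeType (⨁ fun j : Fin N => A (π j)).dim (⨁ fun j : Fin N => A (π j)).X (2 * m) m m c ∧
      c ∉ divisorClassesSpan (⨁ fun j : Fin N => A (π j)).X (⨁ fun j : Fin N => A (π j)).dim m) ↔
    ¬ ((∃ i, ¬ p i) → CMAlgebra.IsNondegenerateFamily (K := fun i : {i // ¬ p i} => K i.1) fun i => Φ i.1) := by
  rw [← isNondegenerateFamily_iff_of_stabConj_slots (Φ := Φ) p hSC h1 h2]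
  constructor
  · rintro ⟨N, π, m, c, hcQ, hcH, hcD⟩ hnd
    exact hnd.not_exists_exceptional_prod hA π m ⟨c, hcQ, hcH, hcD⟩
  · intro hnd
    exact CMAlgebra.exists_exceptional_prod_of_not_isNondegenerateFamily
      (CMAlgebra.isSeparatingFamily_of_isSimple_of_pairwise_not_isIsogenous hA hS hniso) hnd hA

end Geometry

end Summit.HodgeConjecture.CorCM

end
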